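import Mathlib
import Literature.AlgebraicGeometry.HyperbolicPolynomials.SpectrahedralShadow
import Literature.AlgebraicGeometry.HyperbolicPolynomials.SpectrahedralShadowCalculus
import Literature.AlgebraicGeometry.HyperbolicPolynomials.SmoothBoundary
import HarnessLib

/-!
# Smooth hyperbolicity cones are spectrahedral shadows (Netzer–Sanyal 2015, Thm 1.1): the proof

(File `SmoothConeShadow.lean`; the sibling `SpectrahedralShadowProofs.lean` holds the Saunderson–Parrilo
discharge of the other fact of `SpectrahedralShadow.lean`.)

Topic `Literature/AlgebraicGeometry/HyperbolicPolynomials`. This file proves the named fact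
`NetzerSanyal2014_thm11` of `SpectrahedralShadow.lean` CONDITIONALLY on the single deep input of
the printed proof, Helton–Nie's Theorem 2 (Math. Program. 122 (2010) 21–64; = Thm 3.1 of
Helton–Nie, SIAM J. Optim. 20 (2009); = Netzer–Sanyal's Thm 2.3), taken as an explicit
HYPOTHESIS `H` spelled out in the statement (no new named fact is introduced; the notion
`IsStrictlyQuasiConcaveAt` used to phrase it is a definition with body):

* `netzerSanyal2014_thm11_of_heltonNie (H : «Helton–Nie, Thm 2, s.q.c. case») : NetzerSanyal2014_thm11`.

`H` reads: for all `n, m` and `g : Fin m → ℝ[x₁..xₙ]`, if `S = {x | ∀ i, gᵢ(x) ≥ 0}` is compact,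
convex, with non-empty interior, and every `gᵢ` is strictly quasi-concave at every point of `S`,
then `S` is a spectrahedral shadow — Helton–Nie 2010, Thm 2 with no `gᵢ` taken sos-concave.

Everything else in Netzer–Sanyal's argument is proved in the tree: Gårding's convexity theorem
(`Garding.lean`), transversality / pointedness / local structure / Lemma 2.4 (`SmoothBoundary.lean`),
the closure calculus of spectrahedral shadows incl. Helton–Nie 2009 Thm 2.2 and Netzer–Sinn
Prop. 2.1 (`SpectrahedralShadowCalculus.lean`), and the assembly below.

## The assembly (Netzer–Sanyal, §3: proof of Thm 3.1 and of Thm 1.1), for `f` of degree `d`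

* `d = 0`: `Λ₊ = ℝⁿ`; `d = 1`: `f` is a linear form and `Λ₊` a closed half-space
  (`isSpectrahedralShadow_hyperbolicityCone_of_degree_one`). WLOG `f(e) > 0` (`f ↦ -f`).
* `d ≥ 2` (`isSpectrahedralShadow_hyperbolicityCone_of_two_le`): smoothness makes `Λ₊` pointed;
  the trace functional `c = ⟨∇f(e), ·⟩ = f(e) Σλᵢ(·)` is positive on `Λ₊ ∖ 0`
  (`gradForm_dir_pos`), so the base `B = Λ₊ ∩ {c = c(e)} ∋ e` is compact (`isCompact_base`;
  N–S: "there is a hyperplane `H` such that `S = Λ_e(h) ∩ H` is compact … we can assume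
  `e ∈ H`"). In coordinates `y ↦ e + φ₀(y)` on `H` (`φ₀ : ℝⁿ⁻¹ ≅ ker c`) the base becomes a compact
  convex `S' ⊆ ℝⁿ⁻¹` with `0` interior, cut out by the pulled-back polynomial `g` (`affinePullback`).
  Frontier points of `S'` are smooth boundary points of `Λ₊`; by the local structure theorem, a
  small Euclidean ball around such a point meets `S'` in `N = {ε² - |y - a'|² ≥ 0, g ≥ 0}`, a
  compact convex set with non-empty interior whose two defining polynomials are strictly
  quasi-concave at each of its points (the ball polynomial trivially; `g` by Lemma 2.4 (i) at
  interior points and Lemma 2.4 (ii) at boundary points, the line through a boundary point not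
  being contained in the bounded `S'`, `false_of_line_subset` = N–S Remark 3.2). Helton–Nie
  (`H`) makes each `N` a spectrahedral shadow (`isSpectrahedralShadow_inter_ball`); a finite
  subcover of `∂S'`, `ext S' ⊆ ∂S'`, Krein–Milman and the convex hull of a finite union give `S'`
  (`isSpectrahedralShadow_of_frontier_cover`); an affine image gives `B`, and the conical hull
  `Λ₊ = ℝ₊ · B` (`IsSpectrahedralShadow.coneOver`) finishes.

## References

* [NetzerSanyal2014] T. Netzer, R. Sanyal, Math. Program. 153 (2015) 213–221 (arXiv:1208.0441):
  Thm 1.1, §2 (Thm 2.3 = Helton–Nie), §3 (Thm 3.1, Remark 3.2, proof of Thm 1.1).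
* [HeltonNie2008] J. W. Helton, J. Nie, Math. Program. 122 (2010) 21–64, Theorem 2.
* [HeltonNie2009] J. W. Helton, J. Nie, SIAM J. Optim. 20 (2009) 759–791, Theorem 2.2.
* [NetzerSinn2009] T. Netzer, R. Sinn, arXiv:0908.3386, Proposition 2.1.
* [Renegar2006] J. Renegar, Found. Comput. Math. 6 (2006), §2.
-/

noncomputable section

open MvPolynomial
open scoped BigOperators Polynomial

namespace Literature.AlgebraicGeometry.HyperbolicPolynomials

/-! ### Strict quasi-concavity -/

/-- **Strict quasi-concavity of a polynomial at a point** (Helton–Nie, Math. Program. 122 (2010),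
§1: "`-vᵀ∇²gᵢ(x)v > 0` for all `0 ≠ v ∈ ∇gᵢ(x)^⊥`"; when `∇g(u) = 0` this requires `-∇²g(u) ≻ 0`,
cf. Helton–Nie, SIAM J. Optim. 20 (2009), §3.1; Netzer–Sanyal 2015, §2: "for every
`v ∈ ℝⁿ ∖ {0}` we require `vᵀ∇g(a) = 0 ⇒ vᵀH(g;a)v < 0`", equivalently, writing
`g(x + a) = g₀ + g₁(x) + g₂(x) + ⋯` in homogeneous parts, "`g₁(v) = 0 ⇒ g₂(v) < 0`").
Rendered through the line polynomial `t ↦ g(u + tv)`: `coeff 1 = ⟨∇g(u), v⟩` and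
`coeff 2 = ½ vᵀ∇²g(u)v` (`isStrictlyQuasiConcaveAt_iff`).
[cite: HeltonNie2008, §1 (strictly quasi-concave on S)] -/
def IsStrictlyQuasiConcaveAt {σ : Type*} (g : MvPolynomial σ ℝ) (u : σ → ℝ) : Prop :=
  ∀ v : σ → ℝ, v ≠ 0 → (linePoly g u v).coeff 1 = 0 → (linePoly g u v).coeff 2 < 0

/-- Unfolding `IsStrictlyQuasiConcaveAt` in terms of the gradient and the Hessian of `g`:
`∀ v ≠ 0, ⟨∇g(u), v⟩ = 0 → vᵀ ∇²g(u) v < 0`. [cite: HeltonNie2008, §1 (strictly quasi-concave on S)] -/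
theorem isStrictlyQuasiConcaveAt_iff {σ : Type*} [Fintype σ] (g : MvPolynomial σ ℝ) (u : σ → ℝ) :
    IsStrictlyQuasiConcaveAt g u ↔ ∀ v : σ → ℝ, v ≠ 0 →
      (∑ j, v j * MvPolynomial.eval u (pderiv j g)) = 0 →
        (∑ i, ∑ j, v i * v j * MvPolynomial.eval u (pderiv i (pderiv j g))) < 0 := by
  refine forall_congr' fun v => forall_congr' fun _ => ?_
  rw [coeff_one_linePoly, ← two_mul_coeff_two_linePoly]
  constructor
  · intro h h1; have := h h1; linarith
  · intro h h1; have := h h1; linarith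


/-! ## Assembly: Netzer–Sanyal, Theorem 1.1 from Helton–Nie, Theorem 2 -/

section ConvexGeometry

open Filter Topology

variable {E : Type*} [AddCommGroup E] [Module ℝ E] [TopologicalSpace E] [IsTopologicalAddGroup E]
  [ContinuousSMul ℝ E]

/-- The join of two compact sets is compact. [folklore] -/
theorem isCompact_convexJoin {s t : Set E} (hs : IsCompact s) (ht : IsCompact t) :
    IsCompact (convexJoin ℝ s t) := by
  have : convexJoin ℝ s t =
      (fun p : (E × E) × ℝ => (1 - p.2) • p.1.1 + p.2 • p.1.2) '' ((s ×ˢ t) ×ˢ Set.Icc (0 : ℝ) 1) := by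
    ext x
    simp only [mem_convexJoin, segment_eq_image, Set.mem_image, Set.mem_prod, Set.mem_Icc, Prod.exists]
    constructor
    · rintro ⟨a, ha, b, hb, θ, hθ, rfl⟩
      exact ⟨a, b, θ, ⟨⟨ha, hb⟩, hθ⟩, rfl⟩
    · rintro ⟨a, b, θ, ⟨⟨ha, hb⟩, hθ⟩, rfl⟩
      exact ⟨a, ha, b, hb, θ, hθ, rfl⟩
  rw [this]
  refine ((hs.prod ht).prod isCompact_Icc).image ?_
  exact ((continuous_const.sub continuous_snd).smul (continuous_fst.comp continuous_fst)).add
    (continuous_snd.smul (continuous_snd.comp continuous_fst))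

/-- The convex hull of a finite union of compact convex sets is compact. [folklore] -/
theorem isCompact_convexHull_biUnion {κ : Type*} (F : Finset κ) (W : κ → Set E)
    (hW : ∀ i ∈ F, IsCompact (W i)) (hc : ∀ i ∈ F, Convex ℝ (W i)) :
    IsCompact (convexHull ℝ (⋃ i ∈ F, W i)) := by
  classical
  induction F using Finset.induction_on with
  | empty => simp
  | insert j F hj ih =>
      rw [Finset.set_biUnion_insert]
      have hWj := hW j (Finset.mem_insert_self j F)
      have hcj := hc j (Finset.mem_insert_self j F)
      have ih' := ih (fun i hi => hW i (Finset.mem_insert_of_mem hi))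
        (fun i hi => hc i (Finset.mem_insert_of_mem hi))
      by_cases hne₁ : (W j).Nonempty
      · by_cases hne₂ : (⋃ i ∈ F, W i).Nonempty
        · rw [convexHull_union hne₁ hne₂, hcj.convexHull_eq]
          exact isCompact_convexJoin hWj ih'
        · rw [Set.not_nonempty_iff_eq_empty.1 hne₂, Set.union_empty, hcj.convexHull_eq]
          exact hWj
      · rw [Set.not_nonempty_iff_eq_empty.1 hne₁, Set.empty_union]
        exact ih'

/-- Interior points are not extreme (in a space with a non-zero vector): the extreme points of a
set lie on its frontier. [folklore] -/
theorem extremePoints_subset_frontier {s : Set E} {v : E} (hv : v ≠ 0) :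
    s.extremePoints ℝ ⊆ frontier s := by
  intro x hx
  rw [frontier, Set.mem_sdiff]
  refine ⟨subset_closure hx.1, fun hint => ?_⟩
  -- `x ± ε v ∈ s` for small `ε`
  have hs : s ∈ 𝓝 x := mem_interior_iff_mem_nhds.1 hint
  have h1 : Tendsto (fun ε : ℝ => x + ε • v) (𝓝 0) (𝓝 x) :=
    ((continuous_const.add (continuous_id.smul continuous_const) : Continuous fun ε : ℝ => x + ε • v).tendsto' 0 x (by simp))
  have h2 : Tendsto (fun ε : ℝ => x - ε • v) (𝓝 0) (𝓝 x) :=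
    ((continuous_const.sub (continuous_id.smul continuous_const) : Continuous fun ε : ℝ => x - ε • v).tendsto' 0 x (by simp))
  obtain ⟨ε, ⟨hε₁, hε₂⟩, hεpos⟩ :=
    ((((h1.eventually hs).and (h2.eventually hs)).filter_mono nhdsWithin_le_nhds).and
      (self_mem_nhdsWithin (s := Set.Ioi (0 : ℝ)))).exists
  have hεv : ε • v ≠ 0 := smul_ne_zero (Set.mem_Ioi.1 hεpos).ne' hv
  have hmid : x ∈ openSegment ℝ (x + ε • v) (x - ε • v) := by
    refine ⟨1/2, 1/2, by norm_num, by norm_num, by norm_num, ?_⟩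
    module
  have h := hx.2 hε₁ hε₂ hmid
  exact hεv (by rwa [add_eq_left] at h)

end ConvexGeometry


/-! ### The trace functional `x ↦ ⟨∇f(e), x⟩ = f(e) Σ λᵢ(x)` and the compact base -/

section Trace

open Filter Topology

variable {σ : Type*} [Fintype σ] {f : MvPolynomial σ ℝ} {d : ℕ} {e : σ → ℝ}

/-- `⟨∇f(e), x⟩ = f(e) · Σᵢ λᵢ(x)` (the linear term of `f(e + ux) = f(e)∏(1 + λᵢ(x)u)`).
[cite: Renegar2006, §2] -/
theorem gradForm_dir_eq (hf : f.IsHomogeneous d) (he : IsHyperbolic f e) (x : σ → ℝ) :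
    gradForm f e x = MvPolynomial.eval e f * (eigenvalues f e x).sum := by
  rw [gradForm_apply, linePoly_dir_eq_C_mul_prodOneAdd_eigenvalues hf he x, Polynomial.coeff_C_mul,
    coeff_one_prodOneAdd]

omit [Fintype σ] in
/-- If all eigenvalues of `x` vanish then `-x ∈ Λ₊`. [cite: Renegar2006, §2] -/
theorem neg_mem_hyperbolicityCone_of_eigenvalues_eq_zero (hf : f.IsHomogeneous d)
    (he : IsHyperbolic f e) {x : σ → ℝ} (h0 : ∀ lam ∈ eigenvalues f e x, lam = 0) :
    -x ∈ hyperbolicityCone f e := by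
  intro τ hτ
  have h1 : -x + τ • e = (-1 : ℝ) • (x + (-τ) • e) := by simp [neg_smul]
  rw [h1, hf.eval_smul_eq, eval_add_smul_eq_eval_mul_prod_eigenvalues hf he x (-τ)]
  have h2 : ((eigenvalues f e x).map fun lam => -τ + lam) = (eigenvalues f e x).map fun _ => -τ :=
    Multiset.map_congr rfl fun lam hlam => by rw [h0 lam hlam, add_zero]
  rw [h2, Multiset.map_const', Multiset.prod_replicate]
  exact mul_ne_zero (pow_ne_zero _ (by norm_num))
    (mul_ne_zero he.eval_ne_zero (pow_ne_zero _ (by linarith)))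

/-- **The trace functional is strictly positive on a pointed cone**: with `f(e) > 0` and `Λ₊`
pointed, `⟨∇f(e), x⟩ > 0` for `0 ≠ x ∈ Λ₊`. [cite: Renegar2006, §2] -/
theorem gradForm_dir_pos (hf : f.IsHomogeneous d) (he : IsHyperbolic f e)
    (hpos : 0 < MvPolynomial.eval e f)
    (hpt : ∀ x ∈ hyperbolicityCone f e, -x ∈ hyperbolicityCone f e → x = 0)
    {x : σ → ℝ} (hx : x ∈ hyperbolicityCone f e) (hx0 : x ≠ 0) : 0 < gradForm f e x := by
  rw [gradForm_dir_eq hf he]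
  have hnn := (mem_hyperbolicityCone_iff_eigenvalues_nonneg hf he x).1 hx
  refine mul_pos hpos (lt_of_le_of_ne (Multiset.sum_nonneg hnn) fun hsum => hx0 ?_)
  refine hpt x hx (neg_mem_hyperbolicityCone_of_eigenvalues_eq_zero hf he fun lam hlam => ?_)
  have := Multiset.single_le_sum hnn lam hlam
  rw [← hsum] at this
  exact le_antisymm this (hnn lam hlam)

omit [Fintype σ] in
/-- `e ≠ 0` when `d ≥ 1`. [folklore] -/
theorem dir_ne_zero (hf : f.IsHomogeneous d) (he : IsHyperbolic f e) (hd : 1 ≤ d) : e ≠ 0 := by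
  intro h0
  have := hf.eval_smul_eq 0 e
  rw [zero_smul, zero_pow (by omega), zero_mul, ← h0] at this
  exact he.eval_ne_zero this

/-- **The compact base** `{x ∈ Λ₊ | ⟨∇f(e), x⟩ = ⟨∇f(e), e⟩}` of a pointed hyperbolicity cone
(Netzer–Sanyal, proof of Thm 1.1: "there is a hyperplane `H` such that `Λ ∩ H` is compact").
[cite: NetzerSanyal2014, proof of Theorem 1.1] -/
theorem isCompact_base (hf : f.IsHomogeneous d) (he : IsHyperbolic f e)
    (hpos : 0 < MvPolynomial.eval e f)
    (hpt : ∀ x ∈ hyperbolicityCone f e, -x ∈ hyperbolicityCone f e → x = 0) :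
    IsCompact {x ∈ hyperbolicityCone f e | gradForm f e x = gradForm f e e} := by
  have hc : Continuous (gradForm f e) := LinearMap.continuous_of_finiteDimensional _
  refine Metric.isCompact_of_isClosed_isBounded
    ((isClosed_hyperbolicityCone hf he).inter (isClosed_eq hc continuous_const)) ?_
  -- bound via the minimum of the functional on `Λ ∩ sphere`
  set T := hyperbolicityCone f e ∩ Metric.sphere (0 : σ → ℝ) 1 with hT
  have hTc : IsCompact T := (isCompact_sphere 0 1).inter_left (isClosed_hyperbolicityCone hf he)
  rw [Metric.isBounded_iff_subset_closedBall 0]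
  have hsph : ∀ x : σ → ℝ, x ∈ hyperbolicityCone f e → x ≠ 0 → ‖x‖⁻¹ • x ∈ T := fun x hx hx0 =>
    ⟨smul_mem_hyperbolicityCone hf hx (inv_pos.2 (norm_pos_iff.2 hx0)), by
      rw [mem_sphere_zero_iff_norm, norm_smul, norm_inv, norm_norm,
        inv_mul_cancel₀ (norm_pos_iff.2 hx0).ne']⟩
  by_cases hTn : T.Nonempty
  · obtain ⟨x₀, hx₀T, hmin⟩ := hTc.exists_isMinOn hTn hc.continuousOn
    have hx₀0 : x₀ ≠ 0 := by
      intro h0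
      have := hx₀T.2
      rw [h0, mem_sphere_zero_iff_norm, norm_zero] at this
      exact zero_ne_one this
    have hm : 0 < gradForm f e x₀ := gradForm_dir_pos hf he hpos hpt hx₀T.1 hx₀0
    have hce : 0 ≤ gradForm f e e := by
      rw [gradForm_dir_eq hf he]
      exact mul_nonneg hpos.le (Multiset.sum_nonneg
        ((mem_hyperbolicityCone_iff_eigenvalues_nonneg hf he e).1
          (self_mem_hyperbolicityCone hf he.eval_ne_zero)))
    refine ⟨gradForm f e e / gradForm f e x₀, fun x hx => ?_⟩
    obtain ⟨hxΛ, hxc⟩ := hx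
    rw [Metric.mem_closedBall, dist_zero_right]
    rcases eq_or_ne x 0 with rfl | hx0
    · rw [norm_zero]; exact div_nonneg hce hm.le
    · have hxn : 0 < ‖x‖ := norm_pos_iff.2 hx0
      have h1 := (isMinOn_iff.1 hmin) _ (hsph x hxΛ hx0)
      rw [map_smul, smul_eq_mul, hxc] at h1
      rw [le_div_iff₀ hm]
      calc ‖x‖ * gradForm f e x₀ ≤ ‖x‖ * (‖x‖⁻¹ * gradForm f e e) :=
            mul_le_mul_of_nonneg_left h1 hxn.le
        _ = gradForm f e e := by rw [← mul_assoc, mul_inv_cancel₀ hxn.ne', one_mul]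
  · refine ⟨0, fun x hx => ?_⟩
    rcases eq_or_ne x 0 with rfl | hx0
    · simp
    · exact (hTn ⟨_, hsph x hx.1 hx0⟩).elim

end Trace

/-! ### Affine pull-backs and the ball polynomial -/

section Pullback

open scoped Matrix

variable {n k : ℕ}

/-- The affine pull-back `g(y) = h(e + M y)` of `h ∈ ℝ[x₁,…,xₙ]` along `y ↦ e + My`. [folklore] -/
def affinePullback (h : MvPolynomial (Fin n) ℝ) (e : Fin n → ℝ) (M : Matrix (Fin n) (Fin k) ℝ) :
    MvPolynomial (Fin k) ℝ :=
  bind₁ (fun i : Fin n => C (e i) + ∑ l, C (M i l) * X l) h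

/-- [folklore] -/
theorem eval_affinePullback (h : MvPolynomial (Fin n) ℝ) (e : Fin n → ℝ) (M : Matrix (Fin n) (Fin k) ℝ)
    (y : Fin k → ℝ) : MvPolynomial.eval y (affinePullback h e M) = MvPolynomial.eval (e + M *ᵥ y) h := by
  rw [affinePullback, show MvPolynomial.eval y (bind₁ (fun i : Fin n => C (e i) + ∑ l, C (M i l) * X l) h) =
      MvPolynomial.eval (fun i => MvPolynomial.eval y (C (e i) + ∑ l, C (M i l) * X l)) h from
    eval₂Hom_bind₁ _ _ _ _]
  refine congrArg (fun g : Fin n → ℝ => MvPolynomial.eval g h) (funext fun i => ?_)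
  simp [map_sum, Matrix.mulVec, dotProduct]

/-- Line polynomials of the pull-back are line polynomials of `h`. [folklore] -/
theorem linePoly_affinePullback (h : MvPolynomial (Fin n) ℝ) (e : Fin n → ℝ)
    (M : Matrix (Fin n) (Fin k) ℝ) (y v : Fin k → ℝ) :
    linePoly (affinePullback h e M) y v = linePoly h (e + M *ᵥ y) (M *ᵥ v) := by
  refine Polynomial.funext fun t => ?_
  rw [eval_linePoly, eval_linePoly, eval_affinePullback, Matrix.mulVec_add, Matrix.mulVec_smul,
    add_assoc]

/-- The ball polynomial `ε² - Σᵢ (yᵢ - aᵢ)²`. [cite: NetzerSanyal2014, proof of Theorem 3.1] -/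
def ballPoly (a : Fin k → ℝ) (ε : ℝ) : MvPolynomial (Fin k) ℝ :=
  C (ε ^ 2) - ∑ i, (X i - C (a i)) ^ 2

/-- [folklore] -/
theorem eval_ballPoly (a : Fin k → ℝ) (ε : ℝ) (y : Fin k → ℝ) :
    MvPolynomial.eval y (ballPoly a ε) = ε ^ 2 - ∑ i, (y i - a i) ^ 2 := by
  simp [ballPoly]

/-- [folklore] -/
theorem coeff_two_sq_linear (α β : ℝ) :
    ((Polynomial.C α * Polynomial.X + Polynomial.C β) ^ 2).coeff 2 = α ^ 2 := by
  have : (Polynomial.C α * Polynomial.X + Polynomial.C β) ^ 2 =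
      Polynomial.C (α ^ 2) * Polynomial.X ^ 2 + Polynomial.C (2 * α * β) * Polynomial.X +
        Polynomial.C (β ^ 2) := by
    simp only [map_pow, map_mul, map_ofNat]
    ring
  rw [this, Polynomial.coeff_add, Polynomial.coeff_add, Polynomial.coeff_C_mul_X_pow,
    Polynomial.coeff_C_mul_X, Polynomial.coeff_C]
  simp

/-- The line polynomial of the ball polynomial. [folklore] -/
theorem linePoly_ballPoly (a : Fin k → ℝ) (ε : ℝ) (y v : Fin k → ℝ) :
    linePoly (ballPoly a ε) y v =
      Polynomial.C (ε ^ 2) -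
        ∑ i, (Polynomial.C (v i) * Polynomial.X + (Polynomial.C (y i) - Polynomial.C (a i))) ^ 2 := by
  simp only [ballPoly, linePoly, map_sub, map_sum, map_pow, MvPolynomial.aeval_X, MvPolynomial.aeval_C,
    Polynomial.algebraMap_eq]
  refine congrArg (fun s => Polynomial.C ε ^ 2 - s) (Finset.sum_congr rfl fun i _ => by rw [add_sub_assoc])

/-- `coeff 2` of the line polynomial of the ball polynomial is `-|v|²`. [folklore] -/
theorem coeff_two_linePoly_ballPoly (a : Fin k → ℝ) (ε : ℝ) (y v : Fin k → ℝ) :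
    (linePoly (ballPoly a ε) y v).coeff 2 = -∑ i, v i ^ 2 := by
  rw [linePoly_ballPoly, Polynomial.coeff_sub, Polynomial.coeff_C, if_neg (by norm_num), zero_sub,
    Polynomial.finsetSum_coeff, neg_inj]
  refine Finset.sum_congr rfl fun i _ => ?_
  rw [← Polynomial.C_sub, coeff_two_sq_linear]

/-- The ball polynomial is strictly quasi-concave everywhere (Hessian `-2I`; Netzer–Sanyal: "The
function `ε² - ‖b-a‖²` is clearly strictly quasi-concave"). [cite: NetzerSanyal2014, proof of Theorem 3.1] -/
theorem isStrictlyQuasiConcaveAt_ballPoly (a : Fin k → ℝ) (ε : ℝ) (y : Fin k → ℝ) :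
    IsStrictlyQuasiConcaveAt (ballPoly a ε) y := by
  intro v hv _
  rw [coeff_two_linePoly_ballPoly]
  obtain ⟨i, hi⟩ := Function.ne_iff.1 hv
  have : 0 < ∑ j, v j ^ 2 :=
    Finset.sum_pos' (fun j _ => sq_nonneg (v j))
      ⟨i, Finset.mem_univ _, lt_of_le_of_ne (sq_nonneg _) (Ne.symm (pow_ne_zero 2 hi))⟩
  linarith

/-- Euclidean balls `{y | Σ (yᵢ - aᵢ)² ≤ r}` are convex. [folklore] -/
theorem convex_sumSq_le (a : Fin k → ℝ) (r : ℝ) :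
    Convex ℝ {y : Fin k → ℝ | ∑ i, (y i - a i) ^ 2 ≤ r} := by
  intro x hx z hz θ μ hθ hμ hθμ
  simp only [Set.mem_setOf_eq, Pi.add_apply, Pi.smul_apply, smul_eq_mul] at hx hz ⊢
  have hpt : ∀ i, (θ * x i + μ * z i - a i) ^ 2 ≤ θ * (x i - a i) ^ 2 + μ * (z i - a i) ^ 2 := by
    intro i
    have hμ' : μ = 1 - θ := by linarith
    subst hμ'
    nlinarith [mul_nonneg hθ hμ, sq_nonneg (x i - z i)]
  calc ∑ i, (θ * x i + μ * z i - a i) ^ 2 ≤ ∑ i, (θ * (x i - a i) ^ 2 + μ * (z i - a i) ^ 2) :=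
        Finset.sum_le_sum fun i _ => hpt i
    _ = θ * ∑ i, (x i - a i) ^ 2 + μ * ∑ i, (z i - a i) ^ 2 := by
        rw [Finset.sum_add_distrib, Finset.mul_sum, Finset.mul_sum]
    _ ≤ θ * r + μ * r := add_le_add (mul_le_mul_of_nonneg_left hx hθ) (mul_le_mul_of_nonneg_left hz hμ)
    _ = r := by rw [← add_mul, hθμ, one_mul]

/-- Comparison with the sup norm: `Σ (zᵢ)² ≤ k ‖z‖²`. [folklore] -/
theorem sumSq_le_card_mul_norm_sq (z : Fin k → ℝ) : ∑ i, z i ^ 2 ≤ k * ‖z‖ ^ 2 := by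
  calc ∑ i, z i ^ 2 ≤ ∑ _i : Fin k, ‖z‖ ^ 2 := Finset.sum_le_sum fun i _ => by
        have h := norm_le_pi_norm z i
        rw [Real.norm_eq_abs] at h
        nlinarith [abs_nonneg (z i), sq_abs (z i), norm_nonneg z]
    _ = k * ‖z‖ ^ 2 := by simp

/-- Comparison with the sup norm: `‖z‖ < r` if `Σ (zᵢ)² < r²`. [folklore] -/
theorem norm_lt_of_sumSq_lt {z : Fin k → ℝ} {r : ℝ} (hr : 0 < r) (h : ∑ i, z i ^ 2 < r ^ 2) :
    ‖z‖ < r := by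
  rw [pi_norm_lt_iff hr]
  intro i
  have : z i ^ 2 < r ^ 2 :=
    lt_of_le_of_lt (Finset.single_le_sum (fun j _ => sq_nonneg (z j)) (Finset.mem_univ i)) h
  rw [Real.norm_eq_abs]
  exact abs_lt_of_sq_lt_sq' this hr.le |>.2 |> fun h2 => abs_lt.2 ⟨(abs_lt_of_sq_lt_sq' this hr.le).1, h2⟩

end Pullback

/-! ### The main theorem -/

section Main

open Filter Topology
open scoped Matrix

variable {n : ℕ} {f : MvPolynomial (Fin n) ℝ} {d : ℕ} {e : Fin n → ℝ}

/-- Degree `0`: the cone is everything. [folklore] -/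
theorem isSpectrahedralShadow_hyperbolicityCone_of_degree_zero (hf : f.IsHomogeneous 0)
    (he : IsHyperbolic f e) : IsSpectrahedralShadow (hyperbolicityCone f e) := by
  have he0 := he.eval_ne_zero
  have : hyperbolicityCone f e = Set.univ := Set.eq_univ_of_forall fun x τ _ => by
    rw [IsHomogeneous.eval_eq_of_degree_zero hf (x + τ • e) e]; exact he0
  rw [this]
  exact isSpectrahedralShadowOfSize_univ_zero.isSpectrahedralShadow

/-- Degree `1`: the cone is a closed half-space. [folklore] -/
theorem isSpectrahedralShadow_hyperbolicityCone_of_degree_one (hf : f.IsHomogeneous 1)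
    (hpos : 0 < MvPolynomial.eval e f) :
    IsSpectrahedralShadow (hyperbolicityCone f e) := by
  -- `f` is the linear form `gradForm f 0`
  have hlin : ∀ x, MvPolynomial.eval x f = gradForm f 0 x := by
    intro x
    rw [gradForm_apply]
    have : linePoly f 0 x = Polynomial.C (MvPolynomial.eval x f) * Polynomial.X :=
      Polynomial.funext fun t => by
        rw [eval_linePoly, zero_add, hf.eval_smul_eq, pow_one, Polynomial.eval_mul, Polynomial.eval_C,
          Polynomial.eval_X, mul_comm]
    rw [this, Polynomial.coeff_C_mul, Polynomial.coeff_X_one, mul_one]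
  have hset : hyperbolicityCone f e = {x | 0 ≤ gradForm f 0 x} := by
    ext x
    simp only [mem_hyperbolicityCone_iff, Set.mem_setOf_eq]
    constructor
    · intro hx
      by_contra hlt
      push Not at hlt
      have ht : 0 < -gradForm f 0 x / MvPolynomial.eval e f := div_pos (by linarith) hpos
      refine hx _ ht ?_
      rw [hlin, map_add, map_smul, smul_eq_mul, ← hlin e, div_mul_cancel₀ _ hpos.ne', add_neg_cancel]
    · intro hx τ hτ
      rw [hlin, map_add, map_smul, smul_eq_mul, ← hlin e]
      have := mul_pos hτ hpos
      linarith
  rw [hset]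
  refine isSpectrahedralShadow_of_rep_constraints (ι := Fin 0) (V := Fin 0 → ℝ) (κ' := Fin 0) 0 0
    (LinearMap.pi fun _ : Fin 1 => gradForm f 0 ∘ₗ LinearMap.fst ℝ _ _) 0 0 0 fun x => ?_
  simp only [Set.mem_setOf_eq, LinearMap.zero_apply, add_zero, LinearMap.pi_apply, LinearMap.comp_apply,
    LinearMap.fst_apply, Pi.zero_apply, forall_const, exists_const, and_true]
  exact ⟨fun h => ⟨Matrix.PosSemidef.zero, h⟩, fun h => h.2⟩

/-- A line through a point of a closed bounded set, along which membership is an open condition,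
cannot stay inside: used to see that `f` does not vanish identically on tangent lines at boundary
points of the compact base (Netzer–Sanyal, Remark 3.2). [cite: NetzerSanyal2014, Remark 3.2] -/
theorem false_of_line_subset {k : ℕ} {S' : Set (Fin k → ℝ)} (hbdd : Bornology.IsBounded S')
    (hclosed : IsClosed S') {y v : Fin k → ℝ} (hy : y ∈ S') (hv : v ≠ 0)
    (hopen : ∀ u₀ : ℝ, y + u₀ • v ∈ S' → ∀ᶠ u in 𝓝 u₀, y + u • v ∈ S') : False := by
  have hT : {u : ℝ | y + u • v ∈ S'} = Set.univ := by
    refine IsClopen.eq_univ ⟨?_, ?_⟩ ⟨0, by simpa using hy⟩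
    · exact hclosed.preimage (continuous_const.add (continuous_id.smul continuous_const))
    · exact isOpen_iff_mem_nhds.2 fun u₀ hu₀ => hopen u₀ hu₀
  obtain ⟨R, hR⟩ := hbdd.exists_norm_le
  have hR0 : 0 ≤ R := (norm_nonneg y).trans (hR y hy)
  have hvn : 0 < ‖v‖ := norm_pos_iff.2 hv
  have hu : y + ((R + ‖y‖ + 1) / ‖v‖) • v ∈ S' := by
    have : (R + ‖y‖ + 1) / ‖v‖ ∈ {u : ℝ | y + u • v ∈ S'} := by rw [hT]; trivial
    exact this
  have h1 := hR _ hu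
  have hnonneg : 0 ≤ (R + ‖y‖ + 1) / ‖v‖ := div_nonneg (by linarith [norm_nonneg y]) hvn.le
  have h3 := norm_sub_norm_le (((R + ‖y‖ + 1) / ‖v‖) • v) (-y)
  have h4 : ((R + ‖y‖ + 1) / ‖v‖) • v - -y = y + ((R + ‖y‖ + 1) / ‖v‖) • v := by
    rw [sub_neg_eq_add, add_comm]
  rw [h4, norm_neg, norm_smul, Real.norm_eq_abs, abs_of_nonneg hnonneg, div_mul_cancel₀ _ hvn.ne'] at h3
  linarith

/-- The local step of Netzer–Sanyal's proof of Thm 3.1: by Helton–Nie's theorem, a Euclidean ball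
around a point of the closure of the interior of a compact convex `S' ⊆ ℝᵏ`, intersected with `S'`,
is a spectrahedral shadow, provided `S'` is cut out inside the ball by a polynomial `g ≥ 0` that is
strictly quasi-concave on `S'`. [cite: NetzerSanyal2014, proof of Theorem 3.1] -/
theorem isSpectrahedralShadow_inter_ball (H : ∀ (N m : ℕ) (G : Fin m → MvPolynomial (Fin N) ℝ),
      IsCompact {x : Fin N → ℝ | ∀ i, 0 ≤ MvPolynomial.eval x (G i)} →
      Convex ℝ {x : Fin N → ℝ | ∀ i, 0 ≤ MvPolynomial.eval x (G i)} →
      (interior {x : Fin N → ℝ | ∀ i, 0 ≤ MvPolynomial.eval x (G i)}).Nonempty →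
      (∀ i, ∀ x ∈ {x : Fin N → ℝ | ∀ i, 0 ≤ MvPolynomial.eval x (G i)},
          IsStrictlyQuasiConcaveAt (G i) x) →
      IsSpectrahedralShadow {x : Fin N → ℝ | ∀ i, 0 ≤ MvPolynomial.eval x (G i)}) {k : ℕ} {S' : Set (Fin k → ℝ)}
    {g : MvPolynomial (Fin k) ℝ} (hS'compact : IsCompact S') (hS'convex : Convex ℝ S')
    (hsqc : ∀ y ∈ S', IsStrictlyQuasiConcaveAt g y) {a' : Fin k → ℝ}
    (ha'cl : a' ∈ closure (interior S')) {ε : ℝ} (hε : 0 < ε)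
    (hiff : ∀ y, ∑ i, (y i - a' i) ^ 2 ≤ ε ^ 2 → (y ∈ S' ↔ 0 ≤ MvPolynomial.eval y g)) :
    IsSpectrahedralShadow (S' ∩ {y | ∑ i, (y i - a' i) ^ 2 ≤ ε ^ 2}) := by
  have hset : S' ∩ {y | ∑ i, (y i - a' i) ^ 2 ≤ ε ^ 2} =
      {y : Fin k → ℝ | ∀ i : Fin 2,
        0 ≤ MvPolynomial.eval y ((![ballPoly a' ε, g] : Fin 2 → MvPolynomial (Fin k) ℝ) i)} := by
    ext y
    simp only [Set.mem_inter_iff, Set.mem_setOf_eq, Fin.forall_fin_two, Matrix.cons_val_zero,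
      Matrix.cons_val_one, eval_ballPoly, sub_nonneg]
    constructor
    · rintro ⟨hyS, hyb⟩; exact ⟨hyb, (hiff y hyb).1 hyS⟩
    · rintro ⟨hyb, hyg⟩; exact ⟨(hiff y hyb).2 hyg, hyb⟩
  have hcont : Continuous fun y : Fin k → ℝ => ∑ i, (y i - a' i) ^ 2 :=
    continuous_finsetSum _ fun i _ => ((continuous_apply i).sub continuous_const).pow 2
  have hclosedBall : IsClosed {y : Fin k → ℝ | ∑ i, (y i - a' i) ^ 2 ≤ ε ^ 2} :=
    isClosed_le hcont continuous_const
  have hO : IsOpen {y : Fin k → ℝ | ∑ i, (y i - a' i) ^ 2 < ε ^ 2} := isOpen_lt hcont continuous_const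
  have hOsub : {y : Fin k → ℝ | ∑ i, (y i - a' i) ^ 2 < ε ^ 2} ⊆ {y | ∑ i, (y i - a' i) ^ 2 ≤ ε ^ 2} :=
    fun y (hy : ∑ i, (y i - a' i) ^ 2 < ε ^ 2) => (le_of_lt hy : ∑ i, (y i - a' i) ^ 2 ≤ ε ^ 2)
  -- an interior point of `S'` inside the open ball
  obtain ⟨z, hzint, hz⟩ := Metric.mem_closure_iff.1 ha'cl (ε / ((k : ℝ) + 1)) (by positivity)
  have hzball : ∑ i, (z i - a' i) ^ 2 < ε ^ 2 := by
    have hzd : ‖z - a'‖ < ε / ((k : ℝ) + 1) := by rwa [dist_comm, dist_eq_norm] at hz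
    calc ∑ i, (z i - a' i) ^ 2 = ∑ i, (z - a') i ^ 2 := by simp
      _ ≤ k * ‖z - a'‖ ^ 2 := sumSq_le_card_mul_norm_sq _
      _ < ε ^ 2 := by
          have hsq : ‖z - a'‖ ^ 2 < (ε / ((k : ℝ) + 1)) ^ 2 :=
            pow_lt_pow_left₀ hzd (norm_nonneg _) two_ne_zero
          have hkey : (k : ℝ) * (ε / ((k : ℝ) + 1)) ^ 2 ≤ ε ^ 2 := by
            rw [div_pow, ← mul_div_assoc, div_le_iff₀ (by positivity)]
            have hk1 : (k : ℝ) ≤ ((k : ℝ) + 1) ^ 2 := by nlinarith [(Nat.cast_nonneg k : (0 : ℝ) ≤ k)]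
            have := mul_le_mul_of_nonneg_left hk1 (sq_nonneg ε)
            linarith
          rcases (Nat.cast_nonneg k : (0 : ℝ) ≤ k).eq_or_lt with h0 | hkpos
          · rw [← h0, zero_mul]; positivity
          · exact (mul_lt_mul_of_pos_left hsq hkpos).trans_le hkey
  rw [hset]
  apply H
  · rw [← hset]; exact hS'compact.inter_right hclosedBall
  · rw [← hset]; exact hS'convex.inter (convex_sumSq_le a' _)
  · rw [← hset]
    exact ⟨z, by rw [interior_inter]; exact ⟨hzint, interior_maximal hOsub hO hzball⟩⟩
  · rw [← hset]
    rintro i y ⟨hyS, -⟩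
    fin_cases i
    · exact isStrictlyQuasiConcaveAt_ballPoly a' _ y
    · exact hsqc y hyS

/-- The global step of Netzer–Sanyal's proof of Thm 3.1 (for a compact convex `S' ⊆ ℝᵏ`, `k ≥ 1`):
if every frontier point has a Euclidean ball whose intersection with `S'` is a spectrahedral
shadow, then `S'` is one — finite subcover, `ext S' ⊆ ∂S'`, Krein–Milman, convex hull of a finite
union (Helton–Nie 2009, Thm 2.2). [cite: NetzerSanyal2014, proof of Theorem 3.1] -/
theorem isSpectrahedralShadow_of_frontier_cover {k : ℕ} (hk : 0 < k) {S' : Set (Fin k → ℝ)}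
    (hS'compact : IsCompact S') (hS'convex : Convex ℝ S')
    (hN : ∀ a' ∈ frontier S', ∃ ε : ℝ, 0 < ε ∧
      IsSpectrahedralShadow (S' ∩ {y | ∑ i, (y i - a' i) ^ 2 ≤ ε ^ 2})) :
    IsSpectrahedralShadow S' := by
  classical
  choose! ε hε hNsh using hN
  have hS'closed := hS'compact.isClosed
  have hfrc : IsCompact (frontier S') :=
    hS'compact.of_isClosed_subset isClosed_frontier hS'closed.frontier_subset
  have hcont : ∀ a' : Fin k → ℝ, Continuous fun y : Fin k → ℝ => ∑ i, (y i - a' i) ^ 2 := fun a' =>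
    continuous_finsetSum _ fun i _ => ((continuous_apply i).sub continuous_const).pow 2
  have hcover : frontier S' ⊆ ⋃ a' ∈ frontier S', {y | ∑ i, (y i - a' i) ^ 2 < ε a' ^ 2} :=
    fun a' ha' => Set.mem_biUnion ha' (by simpa using pow_pos (hε a' ha') 2)
  obtain ⟨F, hFsub, hFfin, hFcover⟩ := hfrc.elim_finite_subcover_image
    (fun a' _ => isOpen_lt (hcont a') continuous_const) hcover
  have hv₀ : (Pi.single ⟨0, hk⟩ 1 : Fin k → ℝ) ≠ 0 := by
    intro h0; have := congrFun h0 ⟨0, hk⟩; simp at this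
  have hNsub : ∀ a', S' ∩ {y : Fin k → ℝ | ∑ i, (y i - a' i) ^ 2 ≤ ε a' ^ 2} ⊆ S' := fun a' =>
    Set.inter_subset_left
  have hcpt : IsCompact (convexHull ℝ (⋃ a' ∈ hFfin.toFinset,
      (S' ∩ {y | ∑ i, (y i - a' i) ^ 2 ≤ ε a' ^ 2}))) :=
    isCompact_convexHull_biUnion _ _
      (fun a' _ => hS'compact.inter_right (isClosed_le (hcont a') continuous_const))
      (fun a' _ => hS'convex.inter (convex_sumSq_le a' _))
  have hsub : S' ⊆ convexHull ℝ (⋃ a' ∈ hFfin.toFinset,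
      (S' ∩ {y | ∑ i, (y i - a' i) ^ 2 ≤ ε a' ^ 2})) := by
    have hext : S'.extremePoints ℝ ⊆ ⋃ a' ∈ hFfin.toFinset,
        (S' ∩ {y | ∑ i, (y i - a' i) ^ 2 ≤ ε a' ^ 2}) := by
      intro y hy
      have hyS : y ∈ S' := hy.1
      obtain ⟨a', ha', hya'⟩ := Set.mem_iUnion₂.1 (hFcover (extremePoints_subset_frontier hv₀ hy))
      exact Set.mem_iUnion₂.2 ⟨a', hFfin.mem_toFinset.2 ha', hyS,
        (le_of_lt hya' : ∑ i, (y i - a' i) ^ 2 ≤ ε a' ^ 2)⟩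
    calc S' = closure (convexHull ℝ (S'.extremePoints ℝ)) :=
          (closure_convexHull_extremePoints hS'compact hS'convex).symm
      _ ⊆ closure (convexHull ℝ (⋃ a' ∈ hFfin.toFinset,
            (S' ∩ {y | ∑ i, (y i - a' i) ^ 2 ≤ ε a' ^ 2}))) := closure_mono (convexHull_mono hext)
      _ = _ := hcpt.isClosed.closure_eq
  have heq : S' = convexHull ℝ (⋃ a' ∈ hFfin.toFinset,
      (S' ∩ {y | ∑ i, (y i - a' i) ^ 2 ≤ ε a' ^ 2})) :=
    Set.Subset.antisymm hsub (convexHull_min (Set.iUnion₂_subset fun a' _ => hNsub a') hS'convex)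
  rw [heq]
  exact IsSpectrahedralShadow.convexHull_biUnion _ _
    (fun a' ha' => hNsh a' (hFsub (hFfin.mem_toFinset.1 ha')))
    (fun a' _ => hS'compact.isBounded.subset (hNsub a'))
    (fun a' _ => hS'convex.inter (convex_sumSq_le a' _))
    (fun a' ha' => ⟨a', hS'closed.frontier_subset (hFsub (hFfin.mem_toFinset.1 ha')),
      by simpa using (pow_pos (hε a' (hFsub (hFfin.mem_toFinset.1 ha'))) 2).le⟩)

/-- **Netzer–Sanyal, Thm 1.1 for degree `≥ 2`, from Helton–Nie's theorem** (see the module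
docstring for the architecture). [cite: NetzerSanyal2014, Theorem 1.1] -/
theorem isSpectrahedralShadow_hyperbolicityCone_of_two_le (H : ∀ (N m : ℕ) (G : Fin m → MvPolynomial (Fin N) ℝ),
      IsCompact {x : Fin N → ℝ | ∀ i, 0 ≤ MvPolynomial.eval x (G i)} →
      Convex ℝ {x : Fin N → ℝ | ∀ i, 0 ≤ MvPolynomial.eval x (G i)} →
      (interior {x : Fin N → ℝ | ∀ i, 0 ≤ MvPolynomial.eval x (G i)}).Nonempty →
      (∀ i, ∀ x ∈ {x : Fin N → ℝ | ∀ i, 0 ≤ MvPolynomial.eval x (G i)},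
          IsStrictlyQuasiConcaveAt (G i) x) →
      IsSpectrahedralShadow {x : Fin N → ℝ | ∀ i, 0 ≤ MvPolynomial.eval x (G i)})
    (hf : f.IsHomogeneous d) (he : IsHyperbolic f e) (hpos : 0 < MvPolynomial.eval e f) (hd : 2 ≤ d)
    (hsmooth : ∀ a ∈ frontier (hyperbolicityCone f e), a ≠ 0 → ∃ v, (linePoly f a v).coeff 1 ≠ 0) :
    IsSpectrahedralShadow (hyperbolicityCone f e) := by
  classical
  have he0' := he.eval_ne_zero
  -- pointedness
  have hpt : ∀ x ∈ hyperbolicityCone f e, -x ∈ hyperbolicityCone f e → x = 0 :=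
    fun x hx hnx => eq_zero_of_mem_of_neg_mem hf he hd hsmooth hx hnx
  -- `n = 0`
  rcases Nat.eq_zero_or_pos n with hn0 | hn
  · subst hn0
    have : hyperbolicityCone f e = Set.univ := Set.eq_univ_of_forall fun x => by
      rw [Subsingleton.elim x 0]; exact zero_mem_hyperbolicityCone hf he0'
    rw [this]
    exact isSpectrahedralShadowOfSize_univ_zero.isSpectrahedralShadow
  -- the trace functional
  obtain ⟨c, hc⟩ : ∃ c : (Fin n → ℝ) →ₗ[ℝ] ℝ, c = gradForm f e := ⟨_, rfl⟩
  have hcpos : ∀ x ∈ hyperbolicityCone f e, x ≠ 0 → 0 < c x := fun x hx hx0 => by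
    rw [hc]; exact gradForm_dir_pos hf he hpos hpt hx hx0
  have hce : 0 < c e := hcpos e (self_mem_hyperbolicityCone hf he0') (dir_ne_zero hf he (by omega))
  -- the compact base
  obtain ⟨B, hB⟩ : ∃ B : Set (Fin n → ℝ), B = {x ∈ hyperbolicityCone f e | c x = c e} := ⟨_, rfl⟩
  have hBmem : ∀ x, x ∈ B ↔ x ∈ hyperbolicityCone f e ∧ c x = c e := fun x => by rw [hB]; rfl
  have hBc : IsCompact B := by rw [hB, hc]; exact isCompact_base hf he hpos hpt
  have heB : e ∈ B := (hBmem e).2 ⟨self_mem_hyperbolicityCone hf he0', rfl⟩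
  -- coordinates on `ker c`
  have hker : Module.finrank ℝ (LinearMap.ker c) = n - 1 := by
    have h1 := c.finrank_range_add_finrank_ker
    have h2 : Module.finrank ℝ (LinearMap.range c) = 1 := by
      have : LinearMap.range c = ⊤ := LinearMap.range_eq_top.2 fun r =>
        ⟨(r / c e) • e, by rw [map_smul, smul_eq_mul, div_mul_cancel₀ _ hce.ne']⟩
      rw [this, finrank_top, Module.finrank_self]
    rw [h2, Module.finrank_fin_fun] at h1
    omega
  obtain ⟨bK⟩ : Nonempty (Module.Basis (Fin (n - 1)) ℝ (LinearMap.ker c)) :=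
    ⟨Module.finBasisOfFinrankEq ℝ _ hker⟩
  obtain ⟨φ₀, hφ₀⟩ : ∃ φ₀ : (Fin (n - 1) → ℝ) →ₗ[ℝ] (Fin n → ℝ),
      φ₀ = (LinearMap.ker c).subtype ∘ₗ bK.equivFun.symm.toLinearMap := ⟨_, rfl⟩
  have hφ₀ker : ∀ y, c (φ₀ y) = 0 := fun y => by
    rw [hφ₀]; exact LinearMap.mem_ker.1 (Submodule.coe_mem _)
  have hφ₀inj : LinearMap.ker φ₀ = ⊥ := by
    rw [hφ₀]
    exact LinearMap.ker_eq_bot.2 ((LinearMap.ker c).injective_subtype.comp bK.equivFun.symm.injective)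
  have hφ₀surj : ∀ w, c w = 0 → ∃ y, φ₀ y = w := fun w hw =>
    ⟨bK.equivFun ⟨w, LinearMap.mem_ker.2 hw⟩, by rw [hφ₀]; simp⟩
  obtain ⟨M, hM⟩ : ∃ M : Matrix (Fin n) (Fin (n - 1)) ℝ, ∀ y, φ₀ y = M *ᵥ y :=
    ⟨LinearMap.toMatrix' φ₀, fun y => (LinearMap.toMatrix'_mulVec φ₀ y).symm⟩
  -- the pulled-back polynomial and the set `S'`
  obtain ⟨g, hg⟩ : ∃ g : MvPolynomial (Fin (n - 1)) ℝ, g = affinePullback f e M := ⟨_, rfl⟩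
  have hgeval : ∀ y, MvPolynomial.eval y g = MvPolynomial.eval (e + φ₀ y) f := fun y => by
    rw [hg, eval_affinePullback, hM]
  have hglin : ∀ y v, linePoly g y v = linePoly f (e + φ₀ y) (φ₀ v) := fun y v => by
    rw [hg, linePoly_affinePullback, hM, hM]
  obtain ⟨S', hS'⟩ : ∃ S' : Set (Fin (n - 1) → ℝ), S' = {y | e + φ₀ y ∈ hyperbolicityCone f e} :=
    ⟨_, rfl⟩
  have hS'mem : ∀ y, y ∈ S' ↔ e + φ₀ y ∈ hyperbolicityCone f e := fun y => by rw [hS']; rfl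
  have hφcont : Continuous fun y : Fin (n - 1) → ℝ => e + φ₀ y :=
    continuous_const.add φ₀.continuous_of_finiteDimensional
  have hS'closed : IsClosed S' := by
    rw [hS']; exact (isClosed_hyperbolicityCone hf he).preimage hφcont
  have hS'B : ∀ y, y ∈ S' ↔ e + φ₀ y ∈ B := fun y => by
    rw [hS'mem, hBmem, map_add, hφ₀ker, add_zero]; simp
  have hS'compact : IsCompact S' := by
    have h1 : S' = φ₀ ⁻¹' ((Homeomorph.addLeft e) ⁻¹' B) := by
      ext y; rw [hS'B]; simp
    rw [h1]
    exact (LinearMap.isClosedEmbedding_of_injective hφ₀inj).isCompact_preimage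
      ((Homeomorph.addLeft e).isCompact_preimage.2 hBc)
  have hS'bdd : Bornology.IsBounded S' := hS'compact.isBounded
  have hS'convex : Convex ℝ S' := by
    rw [hS']
    exact ((convex_hyperbolicityCone hf he).translate_preimage_right e).linear_preimage φ₀
  -- the interior
  have hUopen : IsOpen {y : Fin (n - 1) → ℝ | e + φ₀ y ∈ openHyperbolicityCone f e} :=
    (he.isOpen_openHyperbolicityCone hf).preimage hφcont
  have hUint : {y : Fin (n - 1) → ℝ | e + φ₀ y ∈ openHyperbolicityCone f e} ⊆ interior S' :=
    interior_maximal (fun y hy => (hS'mem y).2 (openHyperbolicityCone_subset f e hy)) hUopen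
  have h0int : (0 : Fin (n - 1) → ℝ) ∈ interior S' :=
    hUint (by simpa using self_mem_openHyperbolicityCone hf he0')
  -- boundary points of `S'` are smooth boundary points of `Λ`
  have hbdry : ∀ y ∈ S', MvPolynomial.eval (e + φ₀ y) f = 0 →
      e + φ₀ y ≠ 0 ∧ 0 < (linePoly f (e + φ₀ y) e).coeff 1 := by
    intro y hy hzero
    have hmem := (hS'mem y).1 hy
    have hne0 : e + φ₀ y ≠ 0 := fun h0 => by
      have := congrArg c h0
      rw [map_add, hφ₀ker, add_zero, map_zero] at this
      exact hce.ne' this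
    have hfr' : e + φ₀ y ∈ frontier (hyperbolicityCone f e) := by
      rw [frontier_hyperbolicityCone hf he]; exact ⟨hmem, hzero⟩
    exact ⟨hne0, coeff_one_linePoly_dir_pos hf he hpos hmem hzero (hsmooth _ hfr' hne0)⟩
  have hfr : ∀ a' ∈ frontier S', MvPolynomial.eval (e + φ₀ a') f = 0 := by
    intro a' ha'
    by_contra hne
    exact ha'.2 (hUint (mem_openHyperbolicityCone_of_eval_ne_zero
      ((hS'mem a').1 (hS'closed.frontier_subset ha')) hne))
  -- strict quasi-concavity of `g` on `S'`
  have hsqc : ∀ y ∈ S', IsStrictlyQuasiConcaveAt g y := by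
    intro y hy v hv h1
    rw [hglin] at h1 ⊢
    have hV : φ₀ v ≠ 0 := fun h0 => hv (LinearMap.ker_eq_bot.1 hφ₀inj (by rw [h0, map_zero]))
    have hw : e + φ₀ y ∈ hyperbolicityCone f e := (hS'mem y).1 hy
    by_cases hw0 : MvPolynomial.eval (e + φ₀ y) f = 0
    · obtain ⟨hne0, hb1⟩ := hbdry y hy hw0
      refine coeff_two_linePoly_neg_of_boundary hf he hpos hw hw0 hb1 h1 fun hline => ?_
      -- if `f` vanished on the line, the whole line would lie in the bounded set `S'`
      have hpt_eq : ∀ u : ℝ, e + φ₀ (y + u • v) = e + φ₀ y + u • φ₀ v := fun u => by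
        rw [map_add, map_smul, add_assoc]
      have hzero : ∀ u : ℝ, MvPolynomial.eval (e + φ₀ (y + u • v)) f = 0 := fun u => by
        rw [hpt_eq, ← eval_linePoly, hline, Polynomial.eval_zero]
      refine false_of_line_subset hS'bdd hS'closed hy hv fun u₀ hu₀ => ?_
      have hb : e + φ₀ (y + u₀ • v) ∈ hyperbolicityCone f e := (hS'mem _).1 hu₀
      obtain ⟨-, hb1'⟩ := hbdry _ hu₀ (hzero u₀)
      have hev := eventually_mem_hyperbolicityCone_iff hf he hpos hb (hzero u₀) hb1'.ne'
      have hpath : Continuous fun u : ℝ => e + φ₀ (y + u • v) :=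
        hφcont.comp (continuous_const.add (continuous_id.smul continuous_const))
      filter_upwards [hpath.continuousAt.eventually hev] with u hu
      exact (hS'mem _).2 (hu.2 (by rw [hzero]))
    · exact coeff_two_linePoly_neg_of_interior hf he hpos hpt
        (mem_openHyperbolicityCone_of_eval_ne_zero hw hw0) hV h1
  -- the local H–N sets around boundary points are spectrahedral shadows
  have hN : ∀ a' ∈ frontier S', ∃ ε : ℝ, 0 < ε ∧
      IsSpectrahedralShadow (S' ∩ {y | ∑ i, (y i - a' i) ^ 2 ≤ ε ^ 2}) := by
    intro a' ha'
    have ha'S : a' ∈ S' := hS'closed.frontier_subset ha'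
    have hmem := (hS'mem a').1 ha'S
    have hzero := hfr a' ha'
    obtain ⟨-, hb1⟩ := hbdry a' ha'S hzero
    have hev := eventually_mem_hyperbolicityCone_iff hf he hpos hmem hzero hb1.ne'
    obtain ⟨δ, hδ, hball⟩ := Metric.eventually_nhds_iff.1 (hφcont.continuousAt.eventually hev)
    have hiff : ∀ y, ∑ i, (y i - a' i) ^ 2 ≤ (δ / 2) ^ 2 → (y ∈ S' ↔ 0 ≤ MvPolynomial.eval y g) := by
      intro y hy
      have hdist : dist y a' < δ := by
        rw [dist_eq_norm]
        refine norm_lt_of_sumSq_lt hδ (lt_of_le_of_lt ?_ (by nlinarith : (δ / 2) ^ 2 < δ ^ 2))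
        simpa only [Pi.sub_apply] using hy
      rw [hS'mem, hgeval]; exact hball hdist
    have hcl : a' ∈ closure (interior S') := by
      rw [hS'convex.closure_interior_eq_closure_of_nonempty_interior ⟨0, h0int⟩]
      exact frontier_subset_closure ha'
    exact ⟨δ / 2, half_pos hδ,
      isSpectrahedralShadow_inter_ball H hS'compact hS'convex hsqc hcl (half_pos hδ) hiff⟩
  -- `S'` is a spectrahedral shadow
  have hS'shadow : IsSpectrahedralShadow S' := by
    rcases Nat.eq_zero_or_pos (n - 1) with hk0 | hkpos
    · have : S' = Set.univ := Set.eq_univ_of_forall fun y => by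
        have hy : y = 0 := funext fun i => absurd i.2 (by omega)
        rw [hy]; exact interior_subset h0int
      rw [this]
      exact isSpectrahedralShadowOfSize_univ_zero.isSpectrahedralShadow
    · exact isSpectrahedralShadow_of_frontier_cover hkpos hS'compact hS'convex hN
  -- back to `ℝⁿ`: the base `B = e + φ₀(S')` and the cone over it
  have hBeq : B = (fun y => φ₀ y + e) '' S' := by
    ext x
    constructor
    · intro hx
      obtain ⟨-, hxc⟩ := (hBmem x).1 hx
      obtain ⟨y, hy⟩ := hφ₀surj (x - e) (by rw [map_sub, hxc, sub_self])
      refine ⟨y, (hS'B y).2 (by rw [hy, add_sub_cancel]; exact hx), ?_⟩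
      change φ₀ y + e = x
      rw [hy, sub_add_cancel]
    · rintro ⟨y, hy, rfl⟩
      change φ₀ y + e ∈ B
      rw [add_comm]; exact (hS'B y).1 hy
  have hBshadow : IsSpectrahedralShadow B := by rw [hBeq]; exact hS'shadow.affine_image φ₀ e
  have hcone := hBshadow.coneOver hBc.isBounded ⟨e, heB⟩ ((c e)⁻¹ • c) fun s hs => by
    rw [LinearMap.smul_apply, ((hBmem s).1 hs).2, smul_eq_mul, inv_mul_cancel₀ hce.ne']
  have hΛeq : hyperbolicityCone f e = {x | ∃ t : ℝ, 0 ≤ t ∧ ∃ s ∈ B, x = t • s} := by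
    ext x
    constructor
    · intro hx
      rcases eq_or_ne x 0 with rfl | hx0
      · exact ⟨0, le_rfl, e, heB, by rw [zero_smul]⟩
      · have ht : 0 < c x / c e := div_pos (hcpos x hx hx0) hce
        refine ⟨c x / c e, ht.le, (c x / c e)⁻¹ • x, (hBmem _).2 ⟨smul_mem_hyperbolicityCone hf hx
          (inv_pos.2 ht), ?_⟩, by rw [smul_smul, mul_inv_cancel₀ ht.ne', one_smul]⟩
        rw [map_smul, smul_eq_mul, inv_div, div_mul_eq_mul_div, mul_div_assoc,
          div_self (hcpos x hx hx0).ne', mul_one]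
    · rintro ⟨t, ht, s, hs, rfl⟩
      rcases ht.eq_or_lt with h0 | htpos
      · rw [← h0, zero_smul]; exact zero_mem_hyperbolicityCone hf he0'
      · exact smul_mem_hyperbolicityCone hf ((hBmem s).1 hs).1 htpos
  rw [hΛeq]
  exact hcone

/-- **Netzer–Sanyal 2015, Theorem 1.1, from Helton–Nie's Theorem 2** — smooth hyperbolicity
cones are spectrahedral shadows, CONDITIONALLY on the hypothesis `H`, which is verbatim the
strictly-quasi-concave case of Helton–Nie, Math. Program. 122 (2010), Theorem 2 ("Suppose
`S = {x ∈ ℝⁿ : g₁(x) ≥ 0, ⋯, g_m(x) ≥ 0}` is compact convex and has nonempty interior. If each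
`gᵢ(x)` is either sos-concave or strictly quasi-concave on `S`, then `S` is SDP representable")
= Netzer–Sanyal's Theorem 2.3, the one input of the printed proof not proved in this tree (its
proof in print rests on moment relaxations and Positivstellensätze with degree bounds). Every
other step of Netzer–Sanyal's proof is proved (`Garding.lean`, `SmoothBoundary.lean`,
`SpectrahedralShadowCalculus.lean`, this file). Once `H` is available as a theorem, the named fact
`NetzerSanyal2014_thm11` is discharged by applying this theorem to it.
[cite: NetzerSanyal2014, Theorem 1.1] [cite: HeltonNie2008, Theorem 2] -/
theorem netzerSanyal2014_thm11_of_heltonNie (H : ∀ (N m : ℕ) (G : Fin m → MvPolynomial (Fin N) ℝ),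
      IsCompact {x : Fin N → ℝ | ∀ i, 0 ≤ MvPolynomial.eval x (G i)} →
      Convex ℝ {x : Fin N → ℝ | ∀ i, 0 ≤ MvPolynomial.eval x (G i)} →
      (interior {x : Fin N → ℝ | ∀ i, 0 ≤ MvPolynomial.eval x (G i)}).Nonempty →
      (∀ i, ∀ x ∈ {x : Fin N → ℝ | ∀ i, 0 ≤ MvPolynomial.eval x (G i)},
          IsStrictlyQuasiConcaveAt (G i) x) →
      IsSpectrahedralShadow {x : Fin N → ℝ | ∀ i, 0 ≤ MvPolynomial.eval x (G i)}) : NetzerSanyal2014_thm11 := by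
  intro n h e d hf he hsm
  classical
  have hsmooth : ∀ a ∈ frontier (hyperbolicityCone h e), a ≠ 0 → ∃ v, (linePoly h a v).coeff 1 ≠ 0 := by
    intro a ha ha0
    obtain ⟨j, hj⟩ := hsm a ha ha0
    exact ⟨Pi.single j 1, by rwa [coeff_one_linePoly_single]⟩
  -- reduce to `f(e) > 0`
  suffices key : ∀ f : MvPolynomial (Fin n) ℝ, f.IsHomogeneous d → IsHyperbolic f e →
      0 < MvPolynomial.eval e f →
      (∀ a ∈ frontier (hyperbolicityCone f e), a ≠ 0 → ∃ v, (linePoly f a v).coeff 1 ≠ 0) →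
      IsSpectrahedralShadow (hyperbolicityCone f e) by
    rcases lt_or_gt_of_ne he.eval_ne_zero with hneg | hpos
    · have := key (-h) hf.neg (isHyperbolic_neg_iff.2 he) (by rw [map_neg]; linarith) (by
        rw [hyperbolicityCone_neg]
        intro a ha ha0
        obtain ⟨v, hv⟩ := hsmooth a ha ha0
        exact ⟨v, by rwa [linePoly_neg, Polynomial.coeff_neg, neg_ne_zero]⟩)
      rwa [hyperbolicityCone_neg] at this
    · exact key h hf he hpos hsmooth
  intro f hf he hpos hsmooth
  rcases Nat.lt_or_ge d 2 with hd | hd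
  · interval_cases d
    · exact isSpectrahedralShadow_hyperbolicityCone_of_degree_zero hf he
    · exact isSpectrahedralShadow_hyperbolicityCone_of_degree_one hf hpos
  · exact isSpectrahedralShadow_hyperbolicityCone_of_two_le H hf he hpos hd hsmooth

end Main

end Literature.AlgebraicGeometry.HyperbolicPolynomials
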